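import Summits.CriticalPhenomena.Ising3DConformalLimit.Theses.PrecisionLaplacian
import Summits.CriticalPhenomena.Ising3DConformalLimit.Theorems.HyperoctahedralRPExistsScaleCovariantLimitDyadicLimitContinuous
import Summits.CriticalPhenomena.Ising3DConformalLimit.Theorems.MoebiusLimitOfTwoPointLaw.Negative.TranslationFree
import Summits.CriticalPhenomena.Ising3DConformalLimit.Theorems.MoebiusLimitExists.Negative.FreeTranslations
import Summits.CriticalPhenomena.Ising3DConformalLimit.Theorems.PrecisionLaplacianMoebiusLimitOfTwoPointLawInversionBegetsRotations

/-!
# Sketch (crux-ideate round 2, ideator 5) — card `inversion-buys-the-filter`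
Crux stmt-CriticalPhenomena-4801 `PrecisionLaplacian.MoebiusLimitOfTwoPointLaw` (P → Q).

Lever: translations + the unit inversion generate the WHOLE Möbius group of `ℝ³ ∪ {∞}` — not only
`O(3)` (landed group lemma, item 4675 `InversionBegetsRotations`) but also EVERY dilation
(`LemmaB`, PROVED below as `lemmaB_holds`: the dilation by `m²`, `m = 1 + τ²`, along a unit vector `a` is
the word `ι τ_{-(τ/m)a} ι τ_{τa} ι τ_{τa} ι τ_{-(τ/m)a}`, and the four weights multiply to `m⁻¹`); and the exact mesh identity
`S^{u/c}_n(x) = c^{nΔ} S^{u}_n(c • x)` of the CANONICALLY renormalised lattice correlators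
(`rescaledCorrelator_mesh_div`, proved) turns dilation covariance of a limit taken along the single
dyadic sequence `δ_k = 2^{-k}` into convergence along the full filter `δ → 0⁺` (`LemmaA`).
With the landed facts that ANY sequential locally uniform limit of `criticalCorr 3` is continuous and
translation invariant on `NonCoincident` (`continuousOn_seqLimit`, `seqLimit_translate`,
Theorems/HyperoctahedralRPExistsScaleCovariantLimitDyadicLimitContinuous.lean) the crux reduces to
`ReducedCrux`: dyadic canonical convergence of the even arities `n ≥ 4` + unit-inversion covariance of
that dyadic limit. `O(3)`, all non-dyadic dilations and the full filter are OUTPUT: `target_holds : Target`,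
i.e. `MoebiusLimitOfTwoPointLaw ↔ ReducedCrux`, PROVED in this file (no sorry).
-/

noncomputable section

namespace Summit.CriticalPhenomena.Ising3DConformalLimit.Cruxes.MoebiusLimitOfTwoPointLaw.InversionBuysTheFilter

open Literature.Probability.LatticeModels Filter Topology
open Summit.CriticalPhenomena.Ising3DConformalLimit.Theses.PrecisionLaplacian (MoebiusLimitOfTwoPointLaw)

/-- Points of `ℝ³`. -/
abbrev E3 : Type := EuclideanSpace ℝ (Fin 3)

/-- The canonical renormalisation `ρ(δ) = δ^{-Δ}` forced by the two-point law (Disproof `crux_iff_canonical`). -/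
def canonicalRho (Δ : ℝ) : ℝ → ℝ := fun δ => δ ^ (-Δ)

/-- `P`, the hypothesis of the crux at a given `(Δ, c)`: item 0634 read at one witness. -/
def TwoPointLawAt (Δ c : ℝ) : Prop :=
  0 < c ∧ Tendsto (fun x : Site 3 =>
    criticalTwoPoint 3 x * Real.sqrt (∑ i, ((x i : ℝ)) ^ 2) ^ (2 * Δ)) cofinite (nhds c)

/-- **Dyadic canonical limit** (ONE hierarchy): along `δ_k = 2^{-k}` only, the `δ^{-nΔ}`-renormalised
critical correlators of even arity `n ≥ 4` converge locally uniformly off the diagonals to `T n`. -/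
def DyadicCanonicalLimit (Δ : ℝ) (T : CorrFamily 3) : Prop :=
  ∀ n, 4 ≤ n → Even n →
    TendstoLocallyUniformlyOn (fun k : ℕ => rescaledCorrelator (criticalCorr 3) (canonicalRho Δ) n (((2:ℝ) ^ k)⁻¹))
      (T n) atTop (NonCoincident 3 n)

/-- **Unit-inversion covariance** of the even arities `n ≥ 4` of `T`, weight `Δ` (the shape used in the
Disproof's `crux_iff_even_sharper`). -/
def InversionCovariantEven (Δ : ℝ) (T : CorrFamily 3) : Prop :=
  ∀ n, 4 ≤ n → Even n → ∀ x : Fin n → E3, (∀ i, x i ≠ 0) →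
    T n (fun i => EuclideanGeometry.inversion 0 1 (x i)) = (∏ i, ‖x i‖ ^ (2 * Δ)) * T n x

/-- **The reduced crux**: for every witness `(Δ, c)` of the two-point law, SOME family has the dyadic
canonical limits and is unit-inversion covariant. No `O(3)`, no dilation, no full-filter clause. -/
def ReducedCrux : Prop :=
  ∀ Δ c : ℝ, TwoPointLawAt Δ c → ∃ T : CorrFamily 3, DyadicCanonicalLimit Δ T ∧ InversionCovariantEven Δ T

/-- **Target** (the card's theorem, provable now from `LemmaA`, `LemmaB`, item 4675, the landed
`continuousOn_seqLimit`/`seqLimit_translate` and the Disproof's `crux_iff_even_sharper`). -/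
def Target : Prop := MoebiusLimitOfTwoPointLaw ↔ ReducedCrux

/-! ## The exact mesh identity (proved) and Lemma A -/

/-- Rounding commutes with the reparametrisation `δ = u/c ↦ (u, c • x)`: `[x/(u/c)] = [(c•x)/u]`. -/
theorem latticeApprox_mesh_div (u c : ℝ) (y : E3) :
    latticeApprox (u / c) y = latticeApprox u (c • y) := by
  funext j
  simp only [latticeApprox_apply, PiLp.smul_apply, smul_eq_mul]
  congr 1
  rw [div_div_eq_mul_div, mul_comm]

/-- **Exact mesh identity** for the canonical renormalisation: for `u, c > 0`,
`S^{u/c}_n(x) = c^{nΔ} · S^{u}_n(c • x)`, for ANY lattice family (pure bookkeeping: same spins). -/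
theorem rescaledCorrelator_mesh_div (G : LatticeCorrFamily 3) (Δ : ℝ) (n : ℕ) {u c : ℝ}
    (hu : 0 < u) (hc : 0 < c) (x : Fin n → E3) :
    rescaledCorrelator G (canonicalRho Δ) n (u / c) x
      = c ^ ((n : ℝ) * Δ) * rescaledCorrelator G (canonicalRho Δ) n u (fun i => c • x i) := by
  simp only [rescaledCorrelator_apply, canonicalRho]
  have h1 : (fun i => latticeApprox (u / c) (x i)) = fun i => latticeApprox u (c • x i) := by
    funext i
    exact latticeApprox_mesh_div u c (x i)
  have h2 : (u / c) ^ (-Δ) = c ^ Δ * u ^ (-Δ) := by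
    rw [Real.div_rpow hu.le hc.le, Real.rpow_neg hc.le, div_inv_eq_mul, mul_comm]
  have h3 : (c ^ Δ) ^ n = c ^ ((n : ℝ) * Δ) := by
    rw [← Real.rpow_mul_natCast hc.le, mul_comm]
  rw [h1, h2, mul_pow, h3, mul_assoc]

/-- **Lemma A** (model-blind, provable now): a dyadic locally uniform canonical limit which is scale
covariant at arity `n` (all `c > 0`) is the limit along the FULL filter `δ → 0⁺`.
Proof idea: write `δ = 2^{-k}/c`, `c ∈ [1,2)`; by `rescaledCorrelator_mesh_div`,
`S^δ_n(x) = c^{nΔ} S^{2^{-k}}_n(c•x)`, and `{c • y : c ∈ [1,2], y near x}` is a compact subset of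
`NonCoincident`, so local uniformity in `k` plus `c^{nΔ} T(c•x) = T(x)` give local uniformity in `δ`. -/
def LemmaA : Prop :=
  ∀ (G : LatticeCorrFamily 3) (Δ : ℝ) (n : ℕ) (Tn : (Fin n → E3) → ℝ),
    TendstoLocallyUniformlyOn (fun k : ℕ => rescaledCorrelator G (canonicalRho Δ) n (((2:ℝ) ^ k)⁻¹)) Tn atTop
      (NonCoincident 3 n) →
    (∀ c : ℝ, 0 < c → ∀ x : Fin n → E3, Tn (fun i => c • x i) = c ^ (-(n : ℝ) * Δ) * Tn x) →
    TendstoLocallyUniformlyOn (rescaledCorrelator G (canonicalRho Δ) n) Tn (𝓝[>] (0 : ℝ)) (NonCoincident 3 n)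

/-! ## Lemma B: translations + the unit inversion give EVERY dilation -/

/-- The one-dimensional shadow of the dilation word (checked by `norm_num` at `t = u = 1`, where it reads
`x ↦ 4x`): with `m = 1 + t u ≠ 0`, `s = -u/m`, `v = -t/m`, the Möbius word
`K_s ∘ τ_t ∘ K_u ∘ τ_v` (`K_s y = y/(1 + s y) = ι τ_s ι`) is `y ↦ m² y`. Stated on `ℝ`; along a unit
vector `a` of `ℝ³` the same word, with `τ_t := (· + t • a)` and `ι` the unit inversion, is the dilation
by `m²` on all of `ℝ³` (it fixes `0`, `∞`, every plane through `ℝa`, and preserves orientation). -/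
def dilationWord (t u y : ℝ) : ℝ :=
  let m := 1 + t * u
  let s := -u / m
  let v := -t / m
  let K := fun (r z : ℝ) => z / (1 + r * z)
  K s (K u (y + v) + t)

theorem dilationWord_one_one (y : ℝ) (h : 2 * y + 1 ≠ 0) : dilationWord 1 1 y = 4 * y := by
  have ha : (1:ℝ) + y * 2 ≠ 0 := fun hh => h (by linarith)
  have hb : y * 2 + 1 ≠ 0 := fun hh => h (by linarith)
  simp only [dilationWord]
  have e1 : (1:ℝ) + 1 * (y + -1 / (1 + 1 * 1)) = (2 * y + 1) / 2 := by ring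
  have e2 : (y + -1 / ((1:ℝ) + 1 * 1)) / ((2 * y + 1) / 2) + 1 = 4 * y / (2 * y + 1) := by
    field_simp
    ring
  have e3 : (1:ℝ) + -1 / (1 + 1 * 1) * (4 * y / (2 * y + 1)) = 1 / (2 * y + 1) := by
    field_simp
    ring
  rw [e1, e2, e3]
  field_simp

/-- Numeric instances of the dilation word: `y = 1 ↦ 4`, `y = 2 ↦ 8`, `y = -3 ↦ -12`. -/
example : dilationWord 1 1 1 = 4 ∧ dilationWord 1 1 2 = 8 ∧ dilationWord 1 1 (-3) = -12 := by
  norm_num [dilationWord]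

/-- **Lemma B** (provable now, the dilation half of the group lemma; item 4675 is the rotation half):
a translation-invariant, unit-inversion-covariant (weight `Δ`) family is scale covariant with the same `Δ`.
No continuity, no normalisation (poles are avoided by the one-parameter freedom in `(t, u)` with
`(1 + tu)² = c`, exactly as in the landed proof of 4675). -/
def LemmaB : Prop :=
  ∀ (Δ : ℝ) (S : CorrFamily 3), IsTranslationInvariant S → IsInversionCovariant Δ S → IsScaleCovariant Δ S

/-! ## The easy direction of `Target` (sanity: the reduced crux is implied by the crux) -/

/-- `2^{-k} → 0⁺` within `(0, ∞)`. -/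
theorem tendsto_dyadicMesh :
    Tendsto (fun k : ℕ => ((2:ℝ) ^ k)⁻¹) atTop (𝓝[>] (0 : ℝ)) := by
  rw [tendsto_nhdsWithin_iff]
  refine ⟨?_, Eventually.of_forall fun k => Set.mem_Ioi.mpr (by positivity)⟩
  have h : Tendsto (fun k : ℕ => ((2:ℝ)⁻¹) ^ k) atTop (𝓝 0) :=
    tendsto_pow_atTop_nhds_zero_of_lt_one (by norm_num) (by norm_num)
  refine h.congr fun k => ?_
  rw [inv_pow]

/-! ## Proof of Lemma A -/

/-- **Lemma A holds**: dyadic locally uniform convergence of the canonically renormalised correlators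
plus scale covariance of the limit at that arity give convergence along the full filter `δ → 0⁺`.
Model-blind (any lattice family `G`), any `Δ`. [new; elementary] -/
theorem lemmaA_holds : LemmaA := by
  intro G Δ n Tn hd hsc
  rw [tendstoLocallyUniformlyOn_iff_forall_isCompact (isOpen_nonCoincident 3 n)] at hd ⊢
  intro K hK hKc
  -- the compact set of dilated configurations `c • y`, `c ∈ [1,2]`, `y ∈ K`
  set Φ : ℝ × (Fin n → E3) → (Fin n → E3) := fun p => fun i => p.1 • p.2 i with hΦ
  have hΦc : Continuous Φ :=
    continuous_pi fun i => continuous_fst.smul ((continuous_apply i).comp continuous_snd)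
  set K' : Set (Fin n → E3) := Φ '' (Set.Icc (1:ℝ) 2 ×ˢ K) with hK'
  have hK'c : IsCompact K' := (isCompact_Icc.prod hKc).image hΦc
  have hK'sub : K' ⊆ NonCoincident 3 n := by
    rintro _ ⟨⟨c, y⟩, ⟨hc, hy⟩, rfl⟩
    have hc0 : (c : ℝ) ≠ 0 := by
      have : (1:ℝ) ≤ c := hc.1
      positivity
    have hyinj : Function.Injective y := hK hy
    show Function.Injective fun i => c • y i
    intro i j hij
    exact hyinj (smul_right_injective E3 hc0 (by simpa using hij))
  have hU := hd K' hK'sub hK'c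
  rw [Metric.tendstoUniformlyOn_iff] at hU ⊢
  intro ε hε
  set M : ℝ := (2:ℝ) ^ |(n : ℝ) * Δ| with hM
  have hMpos : 0 < M := by positivity
  obtain ⟨k₀, hk₀⟩ := eventually_atTop.1 (hU (ε / M) (by positivity))
  have hpos₀ : (0:ℝ) < ((2:ℝ) ^ k₀)⁻¹ := by positivity
  filter_upwards [Ioo_mem_nhdsGT hpos₀] with δ hδ y hy
  obtain ⟨hδ0, hδ1⟩ := hδ
  -- `δ ≤ 1`, hence `1 ≤ δ⁻¹`
  have hδle : δ ≤ 1 := by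
    have h1 : ((2:ℝ) ^ k₀)⁻¹ ≤ 1 := inv_le_one_of_one_le₀ (one_le_pow₀ (by norm_num))
    linarith
  have hinv1 : (1:ℝ) ≤ δ⁻¹ := (one_le_inv₀ hδ0).2 hδle
  -- the dyadic scale of `δ`: `2^k ≤ δ⁻¹ < 2^(k+1)`
  obtain ⟨k, hk1, hk2⟩ := exists_nat_pow_near hinv1 (by norm_num : (1:ℝ) < 2)
  have hkk₀ : k₀ ≤ k := by
    have h1 : (2:ℝ) ^ k₀ < δ⁻¹ := (lt_inv_comm₀ hδ0 (by positivity)).1 hδ1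
    exact Nat.lt_succ_iff.mp ((pow_lt_pow_iff_right₀ one_lt_two).1 (h1.trans hk2))
  -- the residual dilation `c = δ⁻¹ / 2^k ∈ [1, 2]`
  set c : ℝ := δ⁻¹ / (2:ℝ) ^ k with hc
  have h2k : (0:ℝ) < (2:ℝ) ^ k := by positivity
  have hc1 : 1 ≤ c := (one_le_div h2k).2 hk1
  have hc2 : c ≤ 2 := by
    rw [hc, div_le_iff₀ h2k]
    rw [pow_succ] at hk2
    linarith
  have hcpos : 0 < c := lt_of_lt_of_le one_pos hc1
  have hδeq : ((2:ℝ) ^ k)⁻¹ / c = δ := by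
    rw [hc]
    field_simp
  -- exact mesh identity + scale covariance
  have hmesh := rescaledCorrelator_mesh_div G Δ n (u := ((2:ℝ) ^ k)⁻¹) (by positivity) hcpos y
  rw [hδeq] at hmesh
  have hT : Tn y = c ^ ((n : ℝ) * Δ) * Tn (fun i => c • y i) := by
    rw [hsc c hcpos y, ← mul_assoc, ← Real.rpow_add hcpos]
    have h0 : (n : ℝ) * Δ + -(n : ℝ) * Δ = 0 := by ring
    rw [h0, Real.rpow_zero, one_mul]
  have hmem : (fun i => c • y i) ∈ K' := ⟨⟨c, y⟩, ⟨⟨hc1, hc2⟩, hy⟩, rfl⟩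
  have hest := hk₀ k hkk₀ _ hmem
  rw [Real.dist_eq] at hest ⊢
  rw [hmesh, hT, ← mul_sub, abs_mul, abs_of_pos (Real.rpow_pos_of_pos hcpos _)]
  have hcM : c ^ ((n : ℝ) * Δ) ≤ M :=
    calc c ^ ((n : ℝ) * Δ) ≤ c ^ |(n : ℝ) * Δ| := Real.rpow_le_rpow_of_exponent_le hc1 (le_abs_self _)
      _ ≤ (2:ℝ) ^ |(n : ℝ) * Δ| := Real.rpow_le_rpow hcpos.le hc2 (abs_nonneg _)
  calc c ^ ((n : ℝ) * Δ) * |Tn (fun i => c • y i) -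
          rescaledCorrelator G (canonicalRho Δ) n (((2:ℝ) ^ k)⁻¹) (fun i => c • y i)|
        ≤ M * |Tn (fun i => c • y i) -
          rescaledCorrelator G (canonicalRho Δ) n (((2:ℝ) ^ k)⁻¹) (fun i => c • y i)| :=
        mul_le_mul_of_nonneg_right hcM (abs_nonneg _)
    _ < M * (ε / M) := mul_lt_mul_of_pos_left hest hMpos
    _ = ε := mul_div_cancel₀ _ hMpos.ne'

/-! ## Lemma B, proved: translations + the unit inversion give every dilation -/

section LemmaBProof

open EuclideanGeometry

open Summit.CriticalPhenomena.Ising3DConformalLimit.PrecisionLaplacianMoebiusLimitOfTwoPointLaw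
  (inversion_zero_one_eq_smul)


/-! ### Scalar bookkeeping -/

/-- `‖y + c • a‖² = ‖y‖² + 2c⟪y,a⟫ + c²` for a unit vector `a`. [folklore] -/
theorem normsq_add_smul_unit {a : E3} (ha : ‖a‖ = 1) (y : E3) (c : ℝ) :
    ‖y + c • a‖ ^ 2 = ‖y‖ ^ 2 + 2 * c * inner ℝ y a + c ^ 2 := by
  rw [norm_add_sq_real, norm_smul, real_inner_smul_right, ha, mul_one, Real.norm_eq_abs, sq_abs]
  ring

/-- Inversion of a nonzero scalar multiple: `ι (c • v) = (c ‖v‖²)⁻¹ • v`. [folklore] -/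
theorem inversion_smul_eq {c : ℝ} (hc : c ≠ 0) (v : E3) :
    inversion 0 1 (c • v) = (c * ‖v‖ ^ 2)⁻¹ • v := by
  rw [inversion_zero_one_eq_smul, norm_smul, mul_pow, Real.norm_eq_abs, sq_abs, smul_smul]
  by_cases hv : v = 0
  · simp [hv]
  · have hv2 : ‖v‖ ^ 2 ≠ 0 := by positivity
    congr 1
    field_simp

/-! ### The scalars of the word -/

/-- `m = 1 + τ²`. -/
def mOf (τ : ℝ) : ℝ := 1 + τ ^ 2

theorem mOf_pos (τ : ℝ) : 0 < mOf τ := by unfold mOf; positivity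

theorem mOf_ne (τ : ℝ) : mOf τ ≠ 0 := (mOf_pos τ).ne'

/-- `N₁ = ‖y − (τ/m) a‖² = ‖y‖² − 2(τ/m)⟪y,a⟫ + (τ/m)²`. -/
def N1 (a y : E3) (τ : ℝ) : ℝ :=
  ‖y‖ ^ 2 + 2 * (-(τ / mOf τ)) * inner ℝ y a + (-(τ / mOf τ)) ^ 2

/-- `R = τ (N₁ − 1/m)`. -/
def R1 (a y : E3) (τ : ℝ) : ℝ := τ * (N1 a y τ - 1 / mOf τ)

/-- `M₁ = m⁻² + 2(τ/m)⟪y,a⟫ + τ²‖y‖²` (`= ‖τ y + m⁻¹ a‖²`). -/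
def M1 (a y : E3) (τ : ℝ) : ℝ :=
  (mOf τ ^ 2)⁻¹ + 2 * (τ / mOf τ) * inner ℝ y a + τ ^ 2 * ‖y‖ ^ 2

theorem normsq_z1 {a : E3} (ha : ‖a‖ = 1) (y : E3) (τ : ℝ) :
    ‖y + (-(τ / mOf τ)) • a‖ ^ 2 = N1 a y τ :=
  normsq_add_smul_unit ha y _

/-- The key factorisation of step 2: `‖y + R a‖² = N₁ · M₁`. -/
theorem normsq_step2 {a : E3} (ha : ‖a‖ = 1) (y : E3) (τ : ℝ) :
    ‖y + R1 a y τ • a‖ ^ 2 = N1 a y τ * M1 a y τ := by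
  rw [normsq_add_smul_unit ha]
  have hm0 : mOf τ ≠ 0 := mOf_ne τ
  simp only [R1, N1, M1]
  field_simp
  simp only [mOf]
  ring

/-- Step 3 scalar: `R + τ M₁ = τ m ‖y‖²`. -/
theorem R1_add {a : E3} (y : E3) (τ : ℝ) :
    R1 a y τ + τ * M1 a y τ = τ * mOf τ * ‖y‖ ^ 2 := by
  have hm0 : mOf τ ≠ 0 := mOf_ne τ
  simp only [R1, N1, M1]
  field_simp
  simp only [mOf]
  ring

/-- Step 3 norm: `‖y + (τ m Q) a‖² = m² Q M₁`, `Q = ‖y‖²`. -/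
theorem normsq_step3 {a : E3} (ha : ‖a‖ = 1) (y : E3) (τ : ℝ) :
    ‖y + (τ * mOf τ * ‖y‖ ^ 2) • a‖ ^ 2 = mOf τ ^ 2 * ‖y‖ ^ 2 * M1 a y τ := by
  rw [normsq_add_smul_unit ha]
  have hm0 : mOf τ ≠ 0 := mOf_ne τ
  simp only [M1]
  field_simp

/-- `M₁ = ‖τ y + m⁻¹ a‖²`; in particular `M₁ = 0 ↔ τ • y + (mOf τ)⁻¹ • a = 0`. -/
theorem M1_eq_normsq {a : E3} (ha : ‖a‖ = 1) (y : E3) (τ : ℝ) :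
    M1 a y τ = ‖τ • y + (mOf τ)⁻¹ • a‖ ^ 2 := by
  rw [norm_add_sq_real, norm_smul, norm_smul, real_inner_smul_left, real_inner_smul_right, ha,
    mul_one, Real.norm_eq_abs, Real.norm_eq_abs, mul_pow, sq_abs, sq_abs]
  simp only [M1]
  have hm0 : mOf τ ≠ 0 := mOf_ne τ
  field_simp
  ring

/-! ### The four steps of the word as vectors -/

/-- `z₁ = y − (τ/m) a`. -/
def z1 (a y : E3) (τ : ℝ) : E3 := y + (-(τ / mOf τ)) • a
/-- `z₂ = ι z₁ + τ a`. -/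
def z2 (a y : E3) (τ : ℝ) : E3 := inversion 0 1 (z1 a y τ) + τ • a
/-- `z₃ = ι z₂ + τ a`. -/
def z3 (a y : E3) (τ : ℝ) : E3 := inversion 0 1 (z2 a y τ) + τ • a
/-- `z₄ = ι z₃ − (τ/m) a`. -/
def z4 (a y : E3) (τ : ℝ) : E3 := inversion 0 1 (z3 a y τ) + (-(τ / mOf τ)) • a

section Steps

variable {a : E3} (ha : ‖a‖ = 1) {y : E3} {τ : ℝ}
  (hy : y ≠ 0) (hN : N1 a y τ ≠ 0) (hM : M1 a y τ ≠ 0)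
include ha

theorem normsq_z1' : ‖z1 a y τ‖ ^ 2 = N1 a y τ := normsq_z1 ha y τ

include hN in
/-- `ι z₁ = N₁⁻¹ • z₁` and `z₂ = N₁⁻¹ • (y + R a)`. -/
theorem z2_eq : z2 a y τ = (N1 a y τ)⁻¹ • (y + R1 a y τ • a) := by
  have h1 : inversion 0 1 (z1 a y τ) = (N1 a y τ)⁻¹ • z1 a y τ := by
    rw [inversion_zero_one_eq_smul, normsq_z1' ha]
  show inversion 0 1 (z1 a y τ) + τ • a = _
  rw [h1]
  simp only [z1]
  have hm0 : mOf τ ≠ 0 := mOf_ne τ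
  match_scalars
  · ring
  · simp only [R1]
    field_simp
    try ring

include hN in
theorem normsq_z2 : ‖z2 a y τ‖ ^ 2 = M1 a y τ / N1 a y τ := by
  rw [z2_eq ha hN, norm_smul, mul_pow, Real.norm_eq_abs, sq_abs, normsq_step2 ha]
  field_simp

include hN hM in
/-- `ι z₂ = M₁⁻¹ • (y + R a)` and `z₃ = M₁⁻¹ • (y + τ m ‖y‖² a)`. -/
theorem z3_eq : z3 a y τ = (M1 a y τ)⁻¹ • (y + (τ * mOf τ * ‖y‖ ^ 2) • a) := by
  have h1 : inversion 0 1 (z2 a y τ) = (M1 a y τ)⁻¹ • (y + R1 a y τ • a) := by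
    rw [z2_eq ha hN, inversion_smul_eq (inv_ne_zero hN), normsq_step2 ha]
    congr 1
    field_simp
  show inversion 0 1 (z2 a y τ) + τ • a = _
  rw [h1]
  have hR := R1_add (a := a) y τ
  match_scalars
  · ring
  · have : R1 a y τ = τ * mOf τ * ‖y‖ ^ 2 - τ * M1 a y τ := by linarith
    rw [this]
    field_simp
    try ring

include hN hM in
theorem normsq_z3 : ‖z3 a y τ‖ ^ 2 = mOf τ ^ 2 * ‖y‖ ^ 2 / M1 a y τ := by
  rw [z3_eq ha hN hM, norm_smul, mul_pow, Real.norm_eq_abs, sq_abs, normsq_step3 ha]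
  field_simp

include hy hN hM in
/-- `ι z₃ = (m² ‖y‖²)⁻¹ • (y + τ m ‖y‖² a)` and `z₄ = (m² ‖y‖²)⁻¹ • y`. -/
theorem z4_eq : z4 a y τ = (mOf τ ^ 2 * ‖y‖ ^ 2)⁻¹ • y := by
  have hQ : ‖y‖ ^ 2 ≠ 0 := by positivity
  have hm0 : mOf τ ≠ 0 := mOf_ne τ
  have h1 : inversion 0 1 (z3 a y τ)
      = (mOf τ ^ 2 * ‖y‖ ^ 2)⁻¹ • (y + (τ * mOf τ * ‖y‖ ^ 2) • a) := by
    rw [z3_eq ha hN hM, inversion_smul_eq (inv_ne_zero hM), normsq_step3 ha]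
    congr 1
    field_simp
  show inversion 0 1 (z3 a y τ) + (-(τ / mOf τ)) • a = _
  rw [h1]
  match_scalars
  · ring
  · field_simp
    try ring

include hy hN hM in
theorem normsq_z4 : ‖z4 a y τ‖ ^ 2 = (mOf τ ^ 4 * ‖y‖ ^ 2)⁻¹ := by
  have hQ : ‖y‖ ^ 2 ≠ 0 := by positivity
  have hm0 : mOf τ ≠ 0 := mOf_ne τ
  rw [z4_eq ha hy hN hM, norm_smul, mul_pow, Real.norm_eq_abs, sq_abs]
  field_simp
  try ring

include hy hN hM in
/-- **The word is the dilation by `m²`**: `ι z₄ = m² • y`. -/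
theorem inversion_z4 : inversion 0 1 (z4 a y τ) = (mOf τ ^ 2) • y := by
  have hQ : ‖y‖ ^ 2 ≠ 0 := by positivity
  have hm0 : mOf τ ≠ 0 := mOf_ne τ
  rw [z4_eq ha hy hN hM, inversion_smul_eq (by positivity)]
  congr 1
  field_simp

include hy hN hM in
/-- **The four weights multiply to the dilation weight**: `‖z₁‖‖z₂‖‖z₃‖‖z₄‖ = m⁻¹`. -/
theorem weight_prod : ‖z1 a y τ‖ * ‖z2 a y τ‖ * ‖z3 a y τ‖ * ‖z4 a y τ‖ = (mOf τ)⁻¹ := by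
  have hQ : ‖y‖ ^ 2 ≠ 0 := by positivity
  have hm : 0 < mOf τ := mOf_pos τ
  have h : (‖z1 a y τ‖ * ‖z2 a y τ‖ * ‖z3 a y τ‖ * ‖z4 a y τ‖) ^ 2 = ((mOf τ)⁻¹) ^ 2 := by
    rw [mul_pow, mul_pow, mul_pow, normsq_z1' ha, normsq_z2 ha hN, normsq_z3 ha hN hM,
      normsq_z4 ha hy hN hM]
    field_simp
  exact (pow_left_inj₀ (by positivity) (by positivity) two_ne_zero).1 h

end Steps

/-! ### Correlation families: the word covariance, pole avoidance, and Lemma B -/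

section Covariance

variable {S : CorrFamily 3} {Δ : ℝ}

/-- At a configuration avoiding the three poles (`y ≠ 0`, `N₁ ≠ 0`, `M₁ ≠ 0` pointwise), a
translation-invariant, inversion-covariant family transforms under the dilation by `m²` with the
product of the four inversion weights, i.e. with `∏ (m⁻¹)^{2Δ}`. -/
theorem apply_dilation_of_ne (htr : IsTranslationInvariant S) (hinv : IsInversionCovariant Δ S)
    {a : E3} (ha : ‖a‖ = 1) (τ : ℝ) {n : ℕ} (x : Fin n → E3)
    (hx0 : ∀ i, x i ≠ 0) (hxN : ∀ i, N1 a (x i) τ ≠ 0) (hxM : ∀ i, M1 a (x i) τ ≠ 0) :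
    S n (fun i => (mOf τ ^ 2) • x i) = (∏ _i : Fin n, ((mOf τ)⁻¹) ^ (2 * Δ)) * S n x := by
  have key : ∀ i, ‖z1 a (x i) τ‖ * ‖z2 a (x i) τ‖ * ‖z3 a (x i) τ‖ * ‖z4 a (x i) τ‖ = (mOf τ)⁻¹ :=
    fun i => weight_prod ha (hx0 i) (hxN i) (hxM i)
  have hm : (mOf τ)⁻¹ ≠ 0 := inv_ne_zero (mOf_ne τ)
  have h1 : ∀ i, z1 a (x i) τ ≠ 0 := fun i h => by
    have h' := key i
    rw [h, norm_zero, zero_mul, zero_mul, zero_mul] at h'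
    exact hm h'.symm
  have h2 : ∀ i, z2 a (x i) τ ≠ 0 := fun i h => by
    have h' := key i
    rw [h, norm_zero, mul_zero, zero_mul, zero_mul] at h'
    exact hm h'.symm
  have h3 : ∀ i, z3 a (x i) τ ≠ 0 := fun i h => by
    have h' := key i
    rw [h, norm_zero, mul_zero, zero_mul] at h'
    exact hm h'.symm
  have h4 : ∀ i, z4 a (x i) τ ≠ 0 := fun i h => by
    have h' := key i
    rw [h, norm_zero, mul_zero] at h'
    exact hm h'.symm
  have hcfg : (fun i => (mOf τ ^ 2) • x i) = fun i => inversion 0 1 (z4 a (x i) τ) :=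
    funext fun i => (inversion_z4 ha (hx0 i) (hxN i) (hxM i)).symm
  have t4 : S n (fun i => z4 a (x i) τ) = S n (fun i => inversion 0 1 (z3 a (x i) τ)) :=
    htr n ((-(τ / mOf τ)) • a) (fun i => inversion 0 1 (z3 a (x i) τ))
  have t3 : S n (fun i => z3 a (x i) τ) = S n (fun i => inversion 0 1 (z2 a (x i) τ)) :=
    htr n (τ • a) (fun i => inversion 0 1 (z2 a (x i) τ))
  have t2 : S n (fun i => z2 a (x i) τ) = S n (fun i => inversion 0 1 (z1 a (x i) τ)) :=
    htr n (τ • a) (fun i => inversion 0 1 (z1 a (x i) τ))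
  have t1 : S n (fun i => z1 a (x i) τ) = S n x := htr n ((-(τ / mOf τ)) • a) x
  rw [hcfg, hinv n _ h4, t4, hinv n _ h3, t3, hinv n _ h2, t2, hinv n _ h1, t1,
    ← mul_assoc, ← mul_assoc, ← mul_assoc]
  congr 1
  rw [← Finset.prod_mul_distrib, ← Finset.prod_mul_distrib, ← Finset.prod_mul_distrib]
  refine Finset.prod_congr rfl fun i _ => ?_
  rw [← Real.mul_rpow (norm_nonneg _) (norm_nonneg _),
    ← Real.mul_rpow (mul_nonneg (norm_nonneg _) (norm_nonneg _)) (norm_nonneg _),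
    ← Real.mul_rpow (mul_nonneg (mul_nonneg (norm_nonneg _) (norm_nonneg _)) (norm_nonneg _))
      (norm_nonneg _)]
  congr 1
  rw [← key i]
  ring

/-- Pole avoidance by a generic translation: the word covariance at EVERY configuration
(`τ ≠ 0`). -/
theorem apply_dilation (htr : IsTranslationInvariant S) (hinv : IsInversionCovariant Δ S)
    {a : E3} (ha : ‖a‖ = 1) {τ : ℝ} (hτ : τ ≠ 0) {n : ℕ} (x : Fin n → E3) :
    S n (fun i => (mOf τ ^ 2) • x i) = (∏ _i : Fin n, ((mOf τ)⁻¹) ^ (2 * Δ)) * S n x := by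
  have ha0 : a ≠ 0 := by rw [← norm_ne_zero_iff, ha]; exact one_ne_zero
  haveI : Infinite E3 := Infinite.of_injective (fun c : ℝ => c • a) (smul_left_injective ℝ ha0)
  set p₁ : E3 := (τ / mOf τ) • a with hp₁
  set p₂ : E3 := (-(τ⁻¹ * (mOf τ)⁻¹)) • a with hp₂
  obtain ⟨u, hu⟩ := Infinite.exists_notMem_finset
    (Finset.univ.image (fun i => -x i) ∪ Finset.univ.image (fun i => p₁ - x i) ∪
      Finset.univ.image (fun i => p₂ - x i))
  simp only [Finset.mem_union, Finset.mem_image, Finset.mem_univ, true_and, not_or,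
    not_exists] at hu
  obtain ⟨⟨hu0, hu1⟩, hu2⟩ := hu
  have hy0 : ∀ i, x i + u ≠ 0 := fun i h => hu0 i (add_eq_zero_iff_neg_eq.1 h)
  have hy1 : ∀ i, x i + u ≠ p₁ := fun i h =>
    hu1 i (sub_eq_iff_eq_add.2 (h.symm.trans (add_comm _ _)))
  have hy2 : ∀ i, x i + u ≠ p₂ := fun i h =>
    hu2 i (sub_eq_iff_eq_add.2 (h.symm.trans (add_comm _ _)))
  have hN : ∀ i, N1 a (x i + u) τ ≠ 0 := by
    intro i hN0
    have hz : z1 a (x i + u) τ = 0 := by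
      have h := normsq_z1' ha (y := x i + u) (τ := τ)
      rw [hN0] at h
      exact norm_eq_zero.1 (pow_eq_zero_iff two_ne_zero |>.1 h)
    apply hy1 i
    have : x i + u + (-(τ / mOf τ)) • a = 0 := hz
    rw [hp₁]
    rw [neg_smul, ← sub_eq_add_neg, sub_eq_zero] at this
    exact this
  have hM : ∀ i, M1 a (x i + u) τ ≠ 0 := by
    intro i hM0
    rw [M1_eq_normsq ha] at hM0
    have hz : τ • (x i + u) + (mOf τ)⁻¹ • a = 0 :=
      norm_eq_zero.1 (pow_eq_zero_iff two_ne_zero |>.1 hM0)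
    apply hy2 i
    rw [hp₂]
    have h' : τ • (x i + u) = -((mOf τ)⁻¹ • a) := eq_neg_of_add_eq_zero_left hz
    have h'' : x i + u = τ⁻¹ • (τ • (x i + u)) := by rw [smul_smul, inv_mul_cancel₀ hτ, one_smul]
    rw [h'', h', smul_neg, smul_smul, neg_smul]
  have key := apply_dilation_of_ne htr hinv ha τ (fun i => x i + u) hy0 hN hM
  rw [htr n u x] at key
  have hcfg : (fun i => (mOf τ ^ 2) • (x i + u)) = fun i => (mOf τ ^ 2) • x i + (mOf τ ^ 2) • u :=
    funext fun i => smul_add _ _ _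
  rw [hcfg, htr n _ (fun i => (mOf τ ^ 2) • x i)] at key
  exact key

/-- The product of weights is the dilation weight: `∏ (m⁻¹)^{2Δ} = (m²)^{-nΔ}`. -/
theorem prod_weight_eq (τ : ℝ) (n : ℕ) (Δ : ℝ) :
    (∏ _i : Fin n, ((mOf τ)⁻¹) ^ (2 * Δ)) = (mOf τ ^ 2) ^ (-(n : ℝ) * Δ) := by
  have hm : 0 < mOf τ := mOf_pos τ
  rw [Finset.prod_const, Finset.card_univ, Fintype.card_fin, ← Real.rpow_mul_natCast (by positivity),
    Real.inv_rpow hm.le, ← Real.rpow_neg hm.le]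
  have h2 : (mOf τ ^ 2 : ℝ) = mOf τ ^ (2 : ℝ) := by norm_cast
  rw [h2, ← Real.rpow_mul hm.le]
  congr 1
  ring

/-- Scale covariance for every `c > 1`. -/
theorem scale_of_one_lt (htr : IsTranslationInvariant S) (hinv : IsInversionCovariant Δ S)
    {c : ℝ} (hc : 1 < c) (n : ℕ) (x : Fin n → E3) :
    S n (fun i => c • x i) = c ^ (-(n : ℝ) * Δ) * S n x := by
  -- `c = m²` with `m = 1 + τ²`, `τ = √(√c − 1) ≠ 0`
  set τ : ℝ := Real.sqrt (Real.sqrt c - 1) with hτ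
  have hsc : 1 < Real.sqrt c := by
    rw [show (1:ℝ) = Real.sqrt 1 by simp]
    exact Real.sqrt_lt_sqrt zero_le_one hc
  have hτpos : 0 < τ := Real.sqrt_pos.2 (by linarith)
  have hm : mOf τ = Real.sqrt c := by
    simp only [mOf, hτ]
    rw [Real.sq_sqrt (by linarith)]
    ring
  have hm2 : mOf τ ^ 2 = c := by
    rw [hm, Real.sq_sqrt (by linarith)]
  -- a unit vector
  set a : E3 := EuclideanSpace.single (0 : Fin 3) (1 : ℝ) with ha_def
  have ha : ‖a‖ = 1 := by rw [ha_def, EuclideanSpace.norm_single, norm_one]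
  have key := apply_dilation htr hinv ha hτpos.ne' x
  rw [prod_weight_eq, hm2] at key
  exact key

/-- **Lemma B** (the dilation half of the group lemma): translation invariance and unit-inversion
covariance with weight `Δ` imply scale covariance with the same `Δ` — no continuity, no
normalisation. [new; elementary] -/
theorem lemmaB_holds' (S : CorrFamily 3) (Δ : ℝ) (htr : IsTranslationInvariant S)
    (hinv : IsInversionCovariant Δ S) : IsScaleCovariant Δ S := by
  intro n c hc x
  rcases lt_trichotomy c 1 with hlt | heq | hgt
  · -- `c < 1`: apply the case `c⁻¹ > 1` at the configuration `c • x`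
    have hinv1 : 1 < c⁻¹ := (one_lt_inv₀ hc).2 hlt
    have key := scale_of_one_lt htr hinv hinv1 n (fun i => c • x i)
    have hcfg : (fun i => c⁻¹ • (c • x i)) = x := by
      funext i
      rw [smul_smul, inv_mul_cancel₀ hc.ne', one_smul]
    rw [hcfg, Real.inv_rpow hc.le, ← Real.rpow_neg hc.le, neg_mul, neg_neg] at key
    -- key : S n x = c ^ (n * Δ) * S n (c • x)
    have hcp : (0 : ℝ) < c ^ ((n : ℝ) * Δ) := Real.rpow_pos_of_pos hc _
    rw [key, ← mul_assoc, neg_mul, Real.rpow_neg hc.le, inv_mul_cancel₀ hcp.ne', one_mul]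
  · subst heq
    simp
  · exact scale_of_one_lt htr hinv hgt n x

end Covariance


/-- **Lemma B holds.** -/
theorem lemmaB_holds : LemmaB := fun Δ S htr hinv => lemmaB_holds' S Δ htr hinv

end LemmaBProof

/-! ## The reduction, kernel-checked -/

section Reduction

open Summit.CriticalPhenomena.Ising3DConformalLimit.Cruxes.ExistsScaleCovariantLimit.TwoHierarchies (seqLimit_translate)
open Summit.CriticalPhenomena.Ising3DConformalLimit.Theorems.MoebiusLimitOfTwoPointLaw.Negative
  (moebiusLimitOfTwoPointLaw_iff_even_sharper)
open Summit.CriticalPhenomena.Ising3DConformalLimit.MoebiusLimitExistsNegative (add_mem_nonCoincident_iff)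
open Summit.CriticalPhenomena.Ising3DConformalLimit.PrecisionLaplacianMoebiusLimitOfTwoPointLaw (stub_inversionBegetsRotations)

attribute [local instance] Classical.propDecidable

/-- Re-indexing a locally uniform limit along a sequence of parameters. [folklore] -/
theorem tendstoLocallyUniformlyOn_comp_seq {α : Type*} [TopologicalSpace α] {F : ℝ → α → ℝ} {f : α → ℝ}
    {s : Set α} (h : TendstoLocallyUniformlyOn F f (𝓝[>] (0 : ℝ)) s) {u : ℕ → ℝ}
    (hu : Tendsto u atTop (𝓝[>] (0 : ℝ))) :
    TendstoLocallyUniformlyOn (fun k => F (u k)) f atTop s := by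
  intro w hw x hx
  obtain ⟨t, ht, hev⟩ := h w hw x hx
  exact ⟨t, ht, hu.eventually hev⟩

/-- A locally uniform limit on `s` may be changed off... no: ON `s` to any function agreeing with it on `s`. -/
theorem tendstoLocallyUniformlyOn_congr_limit {α ι : Type*} [TopologicalSpace α] {F : ι → α → ℝ}
    {f g : α → ℝ} {p : Filter ι} {s : Set α} (h : TendstoLocallyUniformlyOn F f p s)
    (hfg : ∀ y ∈ s, f y = g y) : TendstoLocallyUniformlyOn F g p s := by
  intro w hw x hx
  obtain ⟨t, ht, hev⟩ := h w hw x hx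
  refine ⟨t ∩ s, inter_mem ht self_mem_nhdsWithin, hev.mono fun k hk y hy => ?_⟩
  rw [← hfg y hy.2]
  exact hk y hy.1

/-- The normalised family: keep the even arities `n ≥ 4` of `T` on `NonCoincident`, zero elsewhere. -/
def normalise (T : CorrFamily 3) : CorrFamily 3 := fun n x =>
  if 4 ≤ n ∧ Even n ∧ x ∈ NonCoincident 3 n then T n x else 0

theorem normalise_of_mem {T : CorrFamily 3} {n : ℕ} (h4 : 4 ≤ n) (he : Even n)
    {x : Fin n → E3} (hx : x ∈ NonCoincident 3 n) : normalise T n x = T n x := by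
  simp [normalise, h4, he, hx]

theorem normalise_of_not_mem {T : CorrFamily 3} {n : ℕ} {x : Fin n → E3} (hx : x ∉ NonCoincident 3 n) :
    normalise T n x = 0 := by
  simp [normalise, hx]

theorem normalise_of_not_arity {T : CorrFamily 3} {n : ℕ} (hn : ¬ (4 ≤ n ∧ Even n)) (x : Fin n → E3) :
    normalise T n x = 0 := by
  unfold normalise
  rw [if_neg]
  tauto

/-- The unit inversion preserves non-coincidence (it is injective on all of `ℝ³`). -/
theorem inversion_mem_nonCoincident_iff {n : ℕ} (x : Fin n → E3) :
    (fun i => EuclideanGeometry.inversion 0 1 (x i)) ∈ NonCoincident 3 n ↔ x ∈ NonCoincident 3 n := by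
  rw [mem_nonCoincident, mem_nonCoincident]
  constructor
  · intro h i j hij
    exact h (by simp [hij])
  · intro h i j hij
    exact h ((EuclideanGeometry.inversion_involutive (0 : E3) one_ne_zero).injective hij)

/-- **The reduction** (this card's Target), kernel-checked modulo `LemmaB`:
`MoebiusLimitOfTwoPointLaw ↔ ReducedCrux`. Ingredients: Lemma A (proved above), the landed
`seqLimit_translate` (translation invariance of sequential limits of `criticalCorr 3` is free), the landed
group lemma 4675 (`stub_inversionBegetsRotations`: translations + `ι` ⇒ `O(3)`), Lemma B
(translations + `ι` ⇒ dilations) and the Disproof's `moebiusLimitOfTwoPointLaw_iff_even_sharper`. -/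
theorem target_of_lemmaB (hB : LemmaB) : Target := by
  constructor
  · -- the crux gives the reduced crux: restrict the full filter to the dyadic sequence
    intro h Δ c hP
    obtain ⟨T, hT, -, hi⟩ := moebiusLimitOfTwoPointLaw_iff_even_sharper.1 h Δ c hP.1 hP.2
    exact ⟨T, fun n h4 he => tendstoLocallyUniformlyOn_comp_seq (hT n h4 he) tendsto_dyadicMesh, hi⟩
  · intro h
    rw [moebiusLimitOfTwoPointLaw_iff_even_sharper]
    intro Δ c hc hP
    obtain ⟨T, hd, hi⟩ := h Δ c ⟨hc, hP⟩
    -- dyadic convergence to the normalised family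
    have hd' : ∀ n, 4 ≤ n → Even n →
        TendstoLocallyUniformlyOn (fun k : ℕ => rescaledCorrelator (criticalCorr 3) (canonicalRho Δ) n (((2:ℝ) ^ k)⁻¹))
          (normalise T n) atTop (NonCoincident 3 n) := fun n h4 he =>
      tendstoLocallyUniformlyOn_congr_limit (hd n h4 he) fun y hy => (normalise_of_mem h4 he hy).symm
    -- translation invariance is FREE (landed `seqLimit_translate`)
    have htr : IsTranslationInvariant (normalise T) := by
      intro n v x
      by_cases hn : 4 ≤ n ∧ Even n
      · by_cases hx : x ∈ NonCoincident 3 n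
        · exact seqLimit_translate tendsto_dyadicMesh (hd' n hn.1 hn.2) v hx
        · have hxv : (fun i => x i + v) ∉ NonCoincident 3 n := fun h' => hx ((add_mem_nonCoincident_iff v x).1 h')
          rw [normalise_of_not_mem hxv, normalise_of_not_mem hx]
      · rw [normalise_of_not_arity hn, normalise_of_not_arity hn]
    -- unit-inversion covariance of the normalised family (from the hypothesis)
    have hinv : IsInversionCovariant Δ (normalise T) := by
      intro n x hx0
      by_cases hn : 4 ≤ n ∧ Even n
      · by_cases hx : x ∈ NonCoincident 3 n
        · have hιx : (fun i => EuclideanGeometry.inversion 0 1 (x i)) ∈ NonCoincident 3 n :=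
            (inversion_mem_nonCoincident_iff x).2 hx
          rw [normalise_of_mem hn.1 hn.2 hιx, normalise_of_mem hn.1 hn.2 hx]
          exact hi n hn.1 hn.2 x hx0
        · have hιx : (fun i => EuclideanGeometry.inversion 0 1 (x i)) ∉ NonCoincident 3 n :=
            fun h' => hx ((inversion_mem_nonCoincident_iff x).1 h')
          rw [normalise_of_not_mem hιx, normalise_of_not_mem hx, mul_zero]
      · rw [normalise_of_not_arity hn, normalise_of_not_arity hn, mul_zero]
    -- the two halves of the group lemma: dilations (Lemma B) and rotations (item 4675)
    have hsc : IsScaleCovariant Δ (normalise T) := hB Δ (normalise T) htr hinv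
    have hrot : IsRotationInvariant (normalise T) := stub_inversionBegetsRotations Δ (normalise T) htr hinv
    refine ⟨normalise T, ?_, ?_, ?_⟩
    · -- Lemma A: dyadic + dilation covariance ⇒ full filter
      intro n h4 he
      exact lemmaA_holds (criticalCorr 3) Δ n (normalise T n) (hd' n h4 he) (fun c hc x => hsc n c hc x)
    · intro n _ _ R x
      exact hrot n R x
    · intro n _ _ x hx0
      exact hinv n x hx0

/-- **TARGET HOLDS (unconditionally)**: `MoebiusLimitOfTwoPointLaw ↔ ReducedCrux` — under the two-point
law, the crux is EXACTLY dyadic canonical convergence of the even arities `n ≥ 4` plus unit-inversion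
covariance of that dyadic limit; `O(3)`, every dilation and the full filter `δ → 0⁺` are output. -/
theorem target_holds : Target := target_of_lemmaB lemmaB_holds

end Reduction

end Summit.CriticalPhenomena.Ising3DConformalLimit.Cruxes.MoebiusLimitOfTwoPointLaw.InversionBuysTheFilter

end
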